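import Literature.Topology.FourManifolds.KhComplex
import Literature.Topology.FourManifolds.KhComplexQDegreeProofs
import HarnessLib

/-!
# Multiplication and comultiplication on one state circle: the coefficients

Sibling file of `KhComplex.lean`, a brick of the invariance programme for
`Literature.Topology.FourManifolds.GaussDiagram.nonempty_iso_khovanovHomology_of_equiv`
(Khovanov (2000), Thm. 1). The chain maps and homotopies of Khovanov's invariance proof under the
first Reidemeister move (Khovanov (2000), §5.1–5.2; Bar-Natan (2002), §4) are built from the
structure maps of the Frobenius algebra `A = R[X]/(X² - hX - t)` applied to *one* state circle of
an unchanged state: multiplication by an element `x ∈ {1, X}` on the circle through a fixed arc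
`α` (the action of `A` at a base point; Khovanov (2006), *Bar-Natan's theory and the Rasmussen
invariant*: the complex of a pointed diagram is a complex of `A`-modules), and comultiplication
of that circle with the new tensor factor read off separately. In the enhanced-state model of
`KhComplex` these are the matrices

* `actCoeff R h t α x s u` — the coefficient of the enhanced state `u` in `x · s` (`x` multiplying
  the label of the circle of `s` through `α`): `mergeCoeff (s.label α) x (u.label α)` if `u` has
  the state of `s` and its labels off the circle of `α`, and `0` otherwise;
* `coactCoeff R h t α y s u` — the coefficient of `u ⊗ y` in `Δ` applied to the circle of `s`
  through `α`, the second tensor factor being an extra circle labelled `y`: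
  `splitCoeff (s.label α) (u.label α) y` under the same conditions;

with the table identities `actCoeff_false` (`1` acts as the identity), `coactCoeff_true` (the
`X`-component of `Δ` is the identity: `Δ1 = 1 ⊗ X + …`, `ΔX = X ⊗ X + …`) and
`coactCoeff_false` (the `1`-component of `Δ` is `X · (-) - h`). (Commutativity of `m` and
cocommutativity of `Δ` are `KhFace.mergeCoeff_comm` / `KhFace.splitCoeff_comm` of `KhFaces`.)
Everything is proved, for every Gauss diagram; no named fact is introduced.

## References

* M. Khovanov, *A categorification of the Jones polynomial*, Duke Math. J. 101 (2000) 359–426,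
  §2.2 (the algebra `A`), §5.1–5.2. [cite: Khovanov2000, §5.1]
* M. Khovanov, *Link homology and Frobenius extensions*, Fund. Math. 190 (2006) 179–190, §2
  (the universal rank-two system `X² = hX + t`), paragraph *Bar-Natan's theory and the Rasmussen
  invariant* (module structure at a base point). [cite: Khovanov2006, §2]
* D. Bar-Natan, *On Khovanov's categorification of the Jones polynomial*, Algebr. Geom. Topol. 2
  (2002) 337–370, §4. [cite: BarNatan2002, §4]
-/

open Function Set

noncomputable section

namespace Literature.Topology.FourManifolds

namespace GaussDiagram

variable {G : GaussDiagram} (R : Type) [CommRing R]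

/-! ## Tables -/

/-- `1` is the unit: `a · 1 = a`. Khovanov (2000), §2.2. [cite: Khovanov2000, §2.2] -/
theorem mergeCoeff_false_mid (h t : R) (x z : Bool) :
    mergeCoeff R h t x false z = if z = x then 1 else 0 := by
  cases x <;> cases z <;> rfl

/-- The `X`-component of the comultiplication is the identity: `Δ1 = 1 ⊗ X + …`,
`ΔX = X ⊗ X + …` with no other `(-) ⊗ X` terms. Khovanov (2000), §2.2; Khovanov (2006), §2.
[cite: Khovanov2006, §2] -/
theorem splitCoeff_true_right (h t : R) (x y : Bool) :
    splitCoeff R h t x y true = if y = x then 1 else 0 := by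
  cases x <;> cases y <;> rfl

/-- The `1`-component of the comultiplication is multiplication by `X` minus `h`:
`Δ1 = X ⊗ 1 - h 1 ⊗ 1 + …`, `ΔX = t 1 ⊗ 1 + …` versus `X · 1 = X`, `X · X = hX + t`.
Khovanov (2006), §2. [cite: Khovanov2006, §2] -/
theorem splitCoeff_false_right (h t : R) (x y : Bool) :
    splitCoeff R h t x y false = mergeCoeff R h t x true y - if y = x then h else 0 := by
  cases x <;> cases y <;> simp [splitCoeff, mergeCoeff]

/-! ## Acting on the circle through an arc -/

/-- **The coefficient of `u` in `x · s`**, where `x ∈ {1 ↔ false, X ↔ true}` multiplies the label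
of the state circle of the enhanced state `s` through the arc `α` (in `A = R[X]/(X² - hX - t)`):
`mergeCoeff (s.label α) x (u.label α)` if `u` has the same state as `s` and the same labels off
the circle of `α`, and `0` otherwise. Khovanov (2006), §2 and *Bar-Natan's theory and the
Rasmussen invariant* (the `A`-module structure at a base point); Khovanov (2000), §5.1.
[cite: Khovanov2006, §2] -/
def actCoeff (h t : R) (α : G.Arc) (x : Bool) (s u : G.EnhancedState) : R :=
  if u.state = s.state ∧ ∀ c, G.circleOf s.state c ≠ G.circleOf s.state α → u.label c = s.label c
  then mergeCoeff R h t (s.label α) x (u.label α) else 0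

/-- **The coefficient of `u ⊗ y` in the comultiplication applied to the circle of `s` through
`α`**, the second tensor factor being an extra circle labelled `y` (as when a curl is split off at
`α`): `splitCoeff (s.label α) (u.label α) y` if `u` has the same state as `s` and the same labels
off the circle of `α`, and `0` otherwise. Khovanov (2000), §2.2, §5.1; Khovanov (2006), §2.
[cite: Khovanov2000, §5.1] -/
def coactCoeff (h t : R) (α : G.Arc) (y : Bool) (s u : G.EnhancedState) : R :=
  if u.state = s.state ∧ ∀ c, G.circleOf s.state c ≠ G.circleOf s.state α → u.label c = s.label c
  then splitCoeff R h t (s.label α) (u.label α) y else 0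

/-- Two enhanced states with the same state, the same labels off the circle of `α` and the same
label at `α` are equal. [folklore] -/
theorem EnhancedState.eq_of_agree_off_circleOf {α : G.Arc} {s u : G.EnhancedState}
    (hst : u.state = s.state)
    (hoff : ∀ c, G.circleOf s.state c ≠ G.circleOf s.state α → u.label c = s.label c)
    (hα : u.label α = s.label α) : u = s := by
  have hl : u.label = s.label := funext fun c ↦ by
    by_cases hc : G.circleOf s.state c = G.circleOf s.state α
    · rw [s.label_eq_of_circleOf_eq hc, ← hα]
      exact u.label_eq_of_circleOf_eq (by rw [hst]; exact hc)
    · exact hoff c hc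
  cases u; cases s
  simp only at hst hl
  subst hst; subst hl; rfl

/-- **`1` acts as the identity**: the coefficient of `u` in `1 · s` is `[u = s]`. [folklore] -/
theorem actCoeff_false (h t : R) (α : G.Arc) (s u : G.EnhancedState) :
    actCoeff R h t α false s u = if u = s then 1 else 0 := by
  unfold actCoeff
  rw [mergeCoeff_false_mid]
  by_cases hsu : u = s
  · subst hsu; simp
  · rw [if_neg hsu]
    split_ifs with h1 h2
    · exact (hsu (EnhancedState.eq_of_agree_off_circleOf h1.1 h1.2 h2)).elim
    · rfl
    · rfl

/-- **The `X`-component of the comultiplication at `α` is the identity**: the coefficient of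
`u ⊗ X` in `Δ_α s` is `[u = s]`. Khovanov (2000), §5.1 (this is why the curl cancels).
[cite: Khovanov2000, §5.1] -/
theorem coactCoeff_true (h t : R) (α : G.Arc) (s u : G.EnhancedState) :
    coactCoeff R h t α true s u = if u = s then 1 else 0 := by
  unfold coactCoeff
  rw [splitCoeff_true_right]
  by_cases hsu : u = s
  · subst hsu; simp
  · rw [if_neg hsu]
    split_ifs with h1 h2
    · exact (hsu (EnhancedState.eq_of_agree_off_circleOf h1.1 h1.2 h2)).elim
    · rfl
    · rfl

/-- **The `1`-component of the comultiplication at `α` is multiplication by `X` at `α` minus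
`h`**: the coefficient of `u ⊗ 1` in `Δ_α s` is `actCoeff X s u - h [u = s]`. Khovanov (2006), §2.
[cite: Khovanov2006, §2] -/
theorem coactCoeff_false (h t : R) (α : G.Arc) (s u : G.EnhancedState) :
    coactCoeff R h t α false s u = actCoeff R h t α true s u - if u = s then h else 0 := by
  unfold coactCoeff actCoeff
  rw [splitCoeff_false_right]
  by_cases hsu : u = s
  · subst hsu; simp
  · rw [if_neg hsu]
    split_ifs with h1 h2
    · exact (hsu (EnhancedState.eq_of_agree_off_circleOf h1.1 h1.2 h2)).elim
    · simp
    · simp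

/-- A nonzero action coefficient forces the same state. [folklore] -/
theorem state_eq_of_actCoeff_ne_zero {h t : R} {α : G.Arc} {x : Bool} {s u : G.EnhancedState}
    (h0 : actCoeff R h t α x s u ≠ 0) : u.state = s.state := by
  unfold actCoeff at h0
  split_ifs at h0 with h1
  · exact h1.1
  · exact (h0 rfl).elim

/-- A nonzero coaction coefficient forces the same state. [folklore] -/
theorem state_eq_of_coactCoeff_ne_zero {h t : R} {α : G.Arc} {y : Bool} {s u : G.EnhancedState}
    (h0 : coactCoeff R h t α y s u ≠ 0) : u.state = s.state := by
  unfold coactCoeff at h0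
  split_ifs at h0 with h1
  · exact h1.1
  · exact (h0 rfl).elim

end GaussDiagram

end Literature.Topology.FourManifolds
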